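import Literature.Computability.Complexity.CircuitClassesUniformProofs
import Literature.Computability.Complexity.Promise
import Literature.Computability.Complexity.CoinCounting
import HarnessLib

/-!
# Adleman's theorem for promise problems: `promise-BPP ⊆ promise-P/poly`

The textbook promise class `PromiseBPP'` of `Promise.lean` (acceptance probability `≥ 2/3` on
YES-instances, rejection probability `≥ 2/3` on NO-instances, nothing required off the promise) is
contained in `promiseLift PPoly`: every promise problem in promise-`BPP` is SEPARATED by a language
decided by a polynomial-size family of `B₂`-circuits.  This is Adleman's argument (Adleman 1978;
Arora–Barak 2009, Thm. 7.14) run on the promise only: amplify the two-sided error below `2^{-n}` by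
recursive majority, fix by the union bound — over the at most `2ⁿ` PROMISE inputs of length `n` —
one coin vector that is correct on all of them, and hardwire it; off the promise the hardwired
circuit computes whatever it computes, and the separating language is read off the circuits.
Goldreich (2006, §1.2, discussion after Def. 2) records that the standard structural facts about
`BPP`, Adleman's theorem among them, hold for the promise class with the same proofs.

* `mem_promiseLift_PPoly_of_bp_witness` — the `P/poly`-level statement: a two-sided-error witness
  `L' ∈ P/poly` with coin polynomial `p`, correct with probability `≥ 2/3` on the promise of `Q`,
  yields `Q ∈ promiseLift PPoly` (so also "promise-`BP·(P/poly)` ⊆ promise-`P/poly`");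
* `PromiseBPP'_subset_promiseLift_PPoly` — **`PromiseBPP' ⊆ promiseLift PPoly`**, feeding
  `P ⊆ P/poly` (`P_subset_PPoly_holds`, Arora–Barak Thm. 6.6).

All the combinatorics (recursive majority `recMaj`, its circuits `cktSize_recMaj`, the error
recursion `err_le`, the base case `err_zero_le_third`, the union bound
`exists_forall_notMem_of_small`, hardwiring `CktSize.hardwire`) is reused verbatim from the
language-level proof `bp_PPoly_subset_PPoly` of `CircuitClassesProofs.lean`; only the bookkeeping of
the promise is new.

## References

* L. Adleman, *Two theorems on random polynomial time*, FOCS 1978, pp. 75–83.  bib `Adleman1978`.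
* S. Arora, B. Barak, *Computational Complexity: A Modern Approach*, CUP 2009, Thm. 7.14 (p. 136)
  and Thm. 6.6.  bib `AroraBarakCC2009`.
* O. Goldreich, *On promise problems: a survey*, LNCS 3895 (2006) 254–290, §1.2 (Def. 2 and the
  discussion following it).  bib `Goldreich2006`.
-/

namespace Literature.Computability.Complexity

open Finset Polynomial

/-- **Adleman's theorem for promise problems, at the level of `P/poly`.**  If `L' ∈ P/poly` and a
polynomial `p` witness two-sided error `≤ 1/3` ON THE PROMISE of `Q` — on every YES-instance `x` at
least `2/3` of the coin strings `y ∈ {0,1}^{p(|x|)}` have `⟨x, y⟩ ∈ L'`, on every NO-instance at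
least `2/3` have `⟨x, y⟩ ∉ L'` — then some language in `P/poly` contains every YES-instance and no
NO-instance of `Q`.  Proof: Adleman's (Arora–Barak 2009, proof of Thm. 7.14), with the union bound
taken over the promise inputs of each length only (recursive majority of depth `3 + ⌊log₂ n⌋ + 1`
brings the error below `2^{-n}/3`; the YES- and NO-sets are disjoint because the two probabilities
of a common instance would sum to more than `1`). [cite: AroraBarakCC2009, Thm. 7.14]
[cite: Goldreich2006, §1.2 (Def. 2 and discussion)] -/
theorem mem_promiseLift_PPoly_of_bp_witness {Q : PromiseProblem} {L' : Language Bool}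
    (hL' : L' ∈ PPoly) (p : Polynomial ℕ)
    (hyes : ∀ x ∈ Q.yes, 2 / 3 ≤ uniformProb (p.eval x.length) {y : List Bool | boolPair x y ∈ L'})
    (hno : ∀ x ∈ Q.no, 2 / 3 ≤ uniformProb (p.eval x.length) {y : List Bool | boolPair x y ∉ L'}) :
    Q ∈ promiseLift PPoly := by
  classical
  -- the promise is disjoint: acceptance and rejection probabilities of a common instance sum to 1
  have hdisj : ∀ x ∈ Q.yes, x ∉ Q.no := by
    intro x hxy hxn
    have h1 := hyes x hxy
    have h2 := hno x hxn
    have hc : {y : List Bool | boolPair x y ∉ L'} = {y : List Bool | boolPair x y ∈ L'}ᶜ := rfl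
    rw [hc, uniformProb_compl] at h2
    linarith
  obtain ⟨q, hq⟩ := exists_cktSize_boolPair_of_mem_PPoly hL'
  let Np : Polynomial ℕ := 2 * X + 2 + p
  let r : Polynomial ℕ := 27 * (2 * X + 2) ^ 2 * (Np + q.comp Np + 2)
  have hr : ∀ n, r.eval n = 27 * (2 * n + 2) ^ 2 *
      ((2 * n + 2 + p.eval n) + q.eval (2 * n + 2 + p.eval n) + 2) := by
    intro n
    simp [r, Np, eval_comp]
  -- one polynomial-size circuit per length, correct on the promise
  have main : ∀ n : ℕ, ∃ D : Circuit (Fin n), D.IsOver B2 ∧ D.size ≤ r.eval n ∧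
      ∀ u : Fin n → Bool, (List.ofFn u ∈ Q.yes ∨ List.ofFn u ∈ Q.no) →
        D.eval u = Q.yes.boolIndicator (List.ofFn u) := by
    intro n
    set m := p.eval n with hm
    set F : (Fin n → Bool) → (Fin m → Bool) → Bool := fun u v =>
      L'.boolIndicator (boolPair (List.ofFn u) (List.ofFn v)) with hF_def
    set c : (Fin n → Bool) → Bool := fun u => Q.yes.boolIndicator (List.ofFn u) with hc_def
    have hF : CktSize B2 (fun (w : Fin n ⊕ Fin m → Bool) (_ : Unit) =>
        F (fun a => w (.inl a)) (fun b => w (.inr b))) _ := hq n m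
    set j := Nat.log 2 n + 1 with hj
    have hK := cktSize_recMaj hF (3 + j)
    -- base case: error `≤ 1/3` on the promise
    have h0 : ∀ u : Fin n → Bool, (List.ofFn u ∈ Q.yes ∨ List.ofFn u ∈ Q.no) →
        err F 0 u (c u) ≤ 1 / 3 := by
      intro u hu
      refine err_zero_le_third (L := Q.yes) u ?_
      rcases hu with hy | hn'
      · have hset : {y : List Bool | boolPair (List.ofFn u) y ∈ L' ↔ List.ofFn u ∈ Q.yes} =
            {y : List Bool | boolPair (List.ofFn u) y ∈ L'} := by
          ext y
          simp [hy]
        rw [hset]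
        simpa using hyes (List.ofFn u) hy
      · have hny : List.ofFn u ∉ Q.yes := fun hy => hdisj _ hy hn'
        have hset : {y : List Bool | boolPair (List.ofFn u) y ∈ L' ↔ List.ofFn u ∈ Q.yes} =
            {y : List Bool | boolPair (List.ofFn u) y ∉ L'} := by
          ext y
          simp [hny]
        rw [hset]
        simpa using hno (List.ofFn u) hn'
    -- amplified error on the promise
    have herr : ∀ u : Fin n → Bool, (List.ofFn u ∈ Q.yes ∨ List.ofFn u ∈ Q.no) →
        3 * err F (3 + j) u (c u) ≤ (1 / 2) ^ (2 ^ j) := fun u hu =>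
      err_le F u (c u) (h0 u hu) j
    -- wrong coin vectors, counted on the promise only
    let wrong : (Fin n → Bool) → Finset ((Fin (3 + j) → Fin 3) → Fin m → Bool) := fun u =>
      if List.ofFn u ∈ Q.yes ∨ List.ofFn u ∈ Q.no then wrongSet F (3 + j) u (c u) else ∅
    have hsmall : ∀ u : Fin n → Bool, 3 * ((#(wrong u) : ℝ) /
        Fintype.card ((Fin (3 + j) → Fin 3) → Fin m → Bool)) ≤ (1 / 2) ^ (2 ^ j) := by
      intro u
      by_cases hu : List.ofFn u ∈ Q.yes ∨ List.ofFn u ∈ Q.no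
      · simp only [wrong, if_pos hu]
        exact herr u hu
      · simp only [wrong, if_neg hu, card_empty, Nat.cast_zero, zero_div, mul_zero]
        positivity
    -- one coin vector good for all promise inputs
    obtain ⟨ω, hω⟩ : ∃ ω : (Fin (3 + j) → Fin 3) → Fin m → Bool, ∀ u, ω ∉ wrong u :=
      exists_forall_notMem_of_small wrong (Nat.lt_pow_succ_log_self one_lt_two n).le hsmall
    have hωc : ∀ u : Fin n → Bool, (List.ofFn u ∈ Q.yes ∨ List.ofFn u ∈ Q.no) →
        recMaj F (3 + j) u ω = c u := fun u hu => by
      simpa [wrong, hu, wrongSet] using hω u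
    -- hardwire it
    obtain ⟨D, hDB, hDs, hDe⟩ :=
      (hK.hardwire fun cb : (Fin (3 + j) → Fin 3) × Fin m => ω cb.1 cb.2).toCircuit
    refine ⟨D, hDB, hDs.trans ?_, fun u hu => (hDe u).trans (hωc u hu)⟩
    rw [recMajSize_add_two, hr n, pow_add]
    have h3 := three_pow_log_succ_le n
    have : 3 ^ 3 * 3 ^ j * (2 * n + 2 + m + q.eval (2 * n + 2 + m) + 2) ≤
        27 * (2 * n + 2) ^ 2 * (2 * n + 2 + m + q.eval (2 * n + 2 + m) + 2) := by
      gcongr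
      norm_num
    simpa [hm] using this
  choose D hD using main
  -- the separating language: read off the circuits
  let L : Language Bool := {x | (D x.length).eval x.get = true}
  have hLdec : ∀ x : List Bool, (D x.length).eval x.get = L.boolIndicator x := by
    intro x
    by_cases hx : (D x.length).eval x.get = true
    · rw [(Set.mem_iff_boolIndicator L x).1 (show x ∈ L from hx)]
      exact hx
    · rw [(Set.notMem_iff_boolIndicator L x).1 (show x ∉ L from hx)]
      simpa using hx
  refine ⟨L, Set.mem_iUnion.2 ⟨r, D, fun n => ⟨(hD n).1, (hD n).2.1⟩, hLdec⟩,
    fun x hx => ?_, fun x hx hxL => ?_⟩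
  · -- YES-instances are accepted
    show (D x.length).eval x.get = true
    have h := (hD x.length).2.2 x.get (by rw [List.ofFn_get]; exact Or.inl hx)
    rw [List.ofFn_get] at h
    rw [h]
    exact (Set.mem_iff_boolIndicator Q.yes x).1 hx
  · -- NO-instances are rejected
    have hxy : x ∉ Q.yes := fun hy => hdisj x hy hx
    have h := (hD x.length).2.2 x.get (by rw [List.ofFn_get]; exact Or.inr hx)
    rw [List.ofFn_get] at h
    have hxL' : (D x.length).eval x.get = true := hxL
    rw [h, (Set.notMem_iff_boolIndicator Q.yes x).1 hxy] at hxL'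
    exact Bool.false_ne_true hxL'

/-- **Adleman's theorem for promise problems: `promise-BPP ⊆ promise-P/poly`**, i.e.
`PromiseBPP' ⊆ promiseLift PPoly` — every promise problem in textbook promise-`BPP` is separated by
a language with polynomial-size circuits (`mem_promiseLift_PPoly_of_bp_witness` fed with
`P ⊆ P/poly`, `P_subset_PPoly_holds`).  In particular a polynomial-size circuit lower bound for a
promise problem (`Q ∉ promiseLift PPoly`) excludes it from promise-`BPP`. [cite: Adleman1978]
[cite: AroraBarakCC2009, Thm. 7.14] [cite: Goldreich2006, §1.2 (Def. 2 and discussion)] -/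
theorem PromiseBPP'_subset_promiseLift_PPoly : PromiseBPP' ⊆ promiseLift PPoly :=
  fun _ ⟨_, hL', p, hyes, hno⟩ =>
    mem_promiseLift_PPoly_of_bp_witness (P_subset_PPoly_holds hL') p hyes hno

end Literature.Computability.Complexity
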